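import Mathlib
import HarnessLib
import Summits.Ventures.LatticeQCDFlow.Scaling.AcceptanceEssEightNinthsIntegral

/-!
# LatticeQCDFlow / Scaling — the `8/9` law is ATTAINED at every ESS `κ ∈ (0, 3/4]` in the layer-cake
# setting of Part I: cut ramps `b_a = (t − a)₊` on `(0, 1]`

HONEST FRAMING: exact (Metropolis-corrected) sampling algorithms for lattice gauge theory;
figures of merit are autocorrelation/cost numbers at stated couplings and volumes; no
continuum-physics claim.

Venture `LatticeQCDFlow` (cell pub-lqcd), topic `Scaling`; FANOUT row 3 (`s0-u1-a`, S0-B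
implementation A, GEN-9).  NEW WORK of the cell, not a published result; NO definition is
introduced.  Third witness file of the general-space acceptance-vs-ESS envelope:
`Scaling/AcceptanceEssEightNinthsIntegralWitness.lean` (the linear ramp: `κ = 3/4`) and
`Scaling/AcceptanceGiniFloorIntegralWitness.lean` (affine ramps: the Gini piece, `κ ∈ (3/4, 1]`)
work in Part II's vocabulary (`w > 0` pointwise), in which the `8/9` piece below `κ = 3/4` is only
approached, because equality needs an atom of ZERO target weight.  Part I
(`Scaling/AcceptanceEssEightNinthsIntegral.lean`, imported) allows `b ≥ 0`: there the `8/9` piece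
is attained at every `κ ≤ 3/4` by the cut ramps `b_a(t) = (t − a)₊` with flat density on `(0, 1]`
— the weight is `0` with probability `a` and uniform on `(0, 1 − a]` otherwise (the continuous
version of GEN-8's zero-inflated ramps `zeroRamp_accRate_eq_mul_essFrac`).

## What is proved (`μ = volume.restrict (Ioc 0 1)`, `ρ ≡ 1`, `b_a(t) = max (t − a) 0`, `0 ≤ a < 1`)

* `integral_cutRamp` (`∫ b_a = (1 − a)²/2`), `integral_cutRamp_sq` (`∫ b_a² = (1 − a)³/3`),
  `integral_min_cutRamp` (`∫₀¹ min(b_a(x), b_a(y)) dy = (x − a)(1 − a) − (x − a)²/2` for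
  `a < x ≤ 1`), `integral_integral_min_cutRamp` (`∫∫ min(b_a, b_a′) = (1 − a)³/3`);
* **`cutRamp_eight_ninths_eq_overlap`** — in Part I's `ℝ≥0∞` vocabulary: `∫ bρ = (1 − a)²/2`,
  `∫ b²ρ = (1 − a)³/3`, `∫∫ min(b, b′)ρρ′ = (1 − a)³/3 = (8/9)·Z³/W` (EQUALITY in
  `ofReal_eight_ninths_le_overlap`), with the normalised readings `κ = Z²/W = 3(1 − a)/4` (every
  value in `(0, 3/4]`) and acceptance `A/Z = 2(1 − a)/3 = (8/9)·κ`.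

With the two other witness files: on a general measure space the envelope
`max((8/9)κ, 1 − √((1/κ − 1)/3))` is attained at EVERY `κ ∈ (0, 1]` (in Part I's vocabulary;
in Part II's, at every `κ ∈ [3/4, 1]`).  NOT CLAIMED: any number of ours; nothing re-scored.
-/

namespace Summit.Ventures.LatticeQCDFlow.Theory2

open MeasureTheory Set

/-! ### The zero-inflated ramp `b_a(t) = (t − a)₊` on `(0, 1]` with flat density `ρ ≡ 1` (`0 ≤ a < 1`) -/

/-- `∫₀¹ (t − a)₊ dt = (1 − a)²/2`. -/
theorem integral_cutRamp {a : ℝ} (ha0 : 0 ≤ a) (ha1 : a ≤ 1) :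
    ∫ t in Ioc (0 : ℝ) 1, max (t - a) 0 = (1 - a) ^ 2 / 2 := by
  have hii : ∀ u v : ℝ, IntervalIntegrable (fun t : ℝ => max (t - a) 0) volume u v := fun u v =>
    ((continuous_id.sub continuous_const).max continuous_const).intervalIntegrable u v
  rw [← intervalIntegral.integral_of_le zero_le_one,
    ← intervalIntegral.integral_add_adjacent_intervals (hii 0 a) (hii a 1)]
  have h1 : ∫ t in (0 : ℝ)..a, max (t - a) 0 = ∫ _ in (0 : ℝ)..a, (0 : ℝ) :=
    intervalIntegral.integral_congr fun t ht => by
      rw [uIcc_of_le ha0] at ht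
      exact max_eq_right (by linarith [ht.2])
  have h2 : ∫ t in a..(1 : ℝ), max (t - a) 0 = ∫ t in a..(1 : ℝ), (t - a) :=
    intervalIntegral.integral_congr fun t ht => by
      rw [uIcc_of_le ha1] at ht
      exact max_eq_left (by linarith [ht.1])
  have hiy : IntervalIntegrable (fun t : ℝ => t) volume a 1 := continuous_id.intervalIntegrable a 1
  have hic : IntervalIntegrable (fun _ : ℝ => a) volume a 1 := intervalIntegrable_const
  rw [h1, h2, intervalIntegral.integral_const, intervalIntegral.integral_sub hiy hic, integral_id,
    intervalIntegral.integral_const, smul_eq_mul, smul_eq_mul]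
  ring

/-- `∫₀¹ (t − a)₊² dt = (1 − a)³/3`. -/
theorem integral_cutRamp_sq {a : ℝ} (ha0 : 0 ≤ a) (ha1 : a ≤ 1) :
    ∫ t in Ioc (0 : ℝ) 1, (max (t - a) 0) ^ 2 = (1 - a) ^ 3 / 3 := by
  have hii : ∀ u v : ℝ, IntervalIntegrable (fun t : ℝ => (max (t - a) 0) ^ 2) volume u v :=
    fun u v => (((continuous_id.sub continuous_const).max continuous_const).pow 2).intervalIntegrable u v
  rw [← intervalIntegral.integral_of_le zero_le_one,
    ← intervalIntegral.integral_add_adjacent_intervals (hii 0 a) (hii a 1)]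
  have h1 : ∫ t in (0 : ℝ)..a, (max (t - a) 0) ^ 2 = ∫ _ in (0 : ℝ)..a, (0 : ℝ) :=
    intervalIntegral.integral_congr fun t ht => by
      rw [uIcc_of_le ha0] at ht
      show (max (t - a) 0) ^ 2 = 0
      rw [max_eq_right (by linarith [ht.2])]
      ring
  have h2 : ∫ t in a..(1 : ℝ), (max (t - a) 0) ^ 2 = ∫ t in a..(1 : ℝ), (t ^ 2 - (2 * a) * t + a ^ 2) :=
    intervalIntegral.integral_congr fun t ht => by
      rw [uIcc_of_le ha1] at ht
      show (max (t - a) 0) ^ 2 = t ^ 2 - (2 * a) * t + a ^ 2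
      rw [max_eq_left (by linarith [ht.1])]
      ring
  have hi1 : IntervalIntegrable (fun t : ℝ => t ^ 2 - (2 * a) * t) volume a 1 :=
    ((continuous_pow 2).sub (continuous_const.mul continuous_id)).intervalIntegrable a 1
  have hp2 : IntervalIntegrable (fun t : ℝ => t ^ 2) volume a 1 := (continuous_pow 2).intervalIntegrable a 1
  have hlin : IntervalIntegrable (fun t : ℝ => (2 * a) * t) volume a 1 :=
    (continuous_const.mul continuous_id).intervalIntegrable a 1
  have hic : IntervalIntegrable (fun _ : ℝ => a ^ 2) volume a 1 := intervalIntegrable_const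
  rw [h1, h2, intervalIntegral.integral_const, intervalIntegral.integral_add hi1 hic,
    intervalIntegral.integral_sub hp2 hlin, intervalIntegral.integral_const_mul, integral_pow, integral_id,
    intervalIntegral.integral_const, smul_eq_mul, smul_eq_mul]
  ring

/-- The inner overlap integral: for `a < x ≤ 1`,
`∫₀¹ min((x − a)₊, (y − a)₊) dy = (x − a)(1 − a) − (x − a)²/2`. -/
theorem integral_min_cutRamp {a x : ℝ} (ha0 : 0 ≤ a) (hax : a < x) (hx1 : x ≤ 1) :
    ∫ y in Ioc (0 : ℝ) 1, min (max (x - a) 0) (max (y - a) 0) = (x - a) * (1 - a) - (x - a) ^ 2 / 2 := by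
  have hii : ∀ u v : ℝ, IntervalIntegrable (fun y : ℝ => min (max (x - a) 0) (max (y - a) 0)) volume u v :=
    fun u v => (continuous_const.min ((continuous_id.sub continuous_const).max
      continuous_const)).intervalIntegrable u v
  rw [max_eq_left (by linarith : (0:ℝ) ≤ x - a)] at hii ⊢
  rw [← intervalIntegral.integral_of_le zero_le_one,
    ← intervalIntegral.integral_add_adjacent_intervals (hii 0 a) (hii a 1),
    ← intervalIntegral.integral_add_adjacent_intervals (hii a x) (hii x 1)]
  have h1 : ∫ y in (0 : ℝ)..a, min (x - a) (max (y - a) 0) = ∫ _ in (0 : ℝ)..a, (0 : ℝ) :=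
    intervalIntegral.integral_congr fun y hy => by
      rw [uIcc_of_le ha0] at hy
      show min (x - a) (max (y - a) 0) = 0
      rw [max_eq_right (by linarith [hy.2]), min_eq_right (by linarith)]
  have h2 : ∫ y in a..x, min (x - a) (max (y - a) 0) = ∫ y in a..x, (y - a) :=
    intervalIntegral.integral_congr fun y hy => by
      rw [uIcc_of_le hax.le] at hy
      show min (x - a) (max (y - a) 0) = y - a
      rw [max_eq_left (by linarith [hy.1]), min_eq_right (by linarith [hy.2])]
  have h3 : ∫ y in x..(1 : ℝ), min (x - a) (max (y - a) 0) = ∫ _ in x..(1 : ℝ), (x - a) :=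
    intervalIntegral.integral_congr fun y hy => by
      rw [uIcc_of_le hx1] at hy
      show min (x - a) (max (y - a) 0) = x - a
      rw [max_eq_left (by linarith [hy.1]), min_eq_left (by linarith [hy.1])]
  have hiy : IntervalIntegrable (fun y : ℝ => y) volume a x := continuous_id.intervalIntegrable a x
  have hic : IntervalIntegrable (fun _ : ℝ => a) volume a x := intervalIntegrable_const
  rw [h1, h2, h3, intervalIntegral.integral_const, intervalIntegral.integral_sub hiy hic, integral_id,
    intervalIntegral.integral_const, intervalIntegral.integral_const, smul_eq_mul, smul_eq_mul,
    smul_eq_mul]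
  ring

/-- **The overlap**: `∫₀¹∫₀¹ min((x − a)₊, (y − a)₊) dy dx = (1 − a)³/3`. -/
theorem integral_integral_min_cutRamp {a : ℝ} (ha0 : 0 ≤ a) (ha1 : a ≤ 1) :
    ∫ x in Ioc (0 : ℝ) 1, ∫ y in Ioc (0 : ℝ) 1, min (max (x - a) 0) (max (y - a) 0)
      = (1 - a) ^ 3 / 3 := by
  -- the inner integral in closed form on `(0, 1]`
  have e : ∫ x in Ioc (0 : ℝ) 1, ∫ y in Ioc (0 : ℝ) 1, min (max (x - a) 0) (max (y - a) 0)
      = ∫ x in Ioc (0 : ℝ) 1, ((max (x - a) 0) * (1 - a) - (max (x - a) 0) ^ 2 / 2) := by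
    refine setIntegral_congr_fun measurableSet_Ioc fun x hx => ?_
    show ∫ y in Ioc (0 : ℝ) 1, min (max (x - a) 0) (max (y - a) 0)
      = (max (x - a) 0) * (1 - a) - (max (x - a) 0) ^ 2 / 2
    rcases le_or_gt x a with h | h
    · rw [max_eq_right (by linarith)]
      have e0 : ∫ y in Ioc (0 : ℝ) 1, min (0 : ℝ) (max (y - a) 0) = ∫ y in Ioc (0 : ℝ) 1, (0 : ℝ) :=
        setIntegral_congr_fun measurableSet_Ioc fun y _ => min_eq_left (le_max_right _ _)
      rw [e0, integral_zero]
      ring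
    · rw [integral_min_cutRamp ha0 h hx.2, max_eq_left (by linarith)]
  have hii : ∀ u v : ℝ, IntervalIntegrable
      (fun x : ℝ => (max (x - a) 0) * (1 - a) - (max (x - a) 0) ^ 2 / 2) volume u v := fun u v =>
    ((((continuous_id.sub continuous_const).max continuous_const).mul continuous_const).sub
      ((((continuous_id.sub continuous_const).max continuous_const).pow 2).div_const 2)).intervalIntegrable
      u v
  rw [e, ← intervalIntegral.integral_of_le zero_le_one,
    ← intervalIntegral.integral_add_adjacent_intervals (hii 0 a) (hii a 1)]
  have h1 : ∫ x in (0 : ℝ)..a, ((max (x - a) 0) * (1 - a) - (max (x - a) 0) ^ 2 / 2)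
      = ∫ _ in (0 : ℝ)..a, (0 : ℝ) :=
    intervalIntegral.integral_congr fun x hx => by
      rw [uIcc_of_le ha0] at hx
      show (max (x - a) 0) * (1 - a) - (max (x - a) 0) ^ 2 / 2 = 0
      rw [max_eq_right (by linarith [hx.2])]
      ring
  have h2 : ∫ x in a..(1 : ℝ), ((max (x - a) 0) * (1 - a) - (max (x - a) 0) ^ 2 / 2)
      = ∫ x in a..(1 : ℝ), ((-(1 / 2 : ℝ)) * x ^ 2 + (1 : ℝ) * x + (-(a * (1 - a)) - a ^ 2 / 2)) :=
    intervalIntegral.integral_congr fun x hx => by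
      rw [uIcc_of_le ha1] at hx
      show (max (x - a) 0) * (1 - a) - (max (x - a) 0) ^ 2 / 2
        = (-(1 / 2 : ℝ)) * x ^ 2 + (1 : ℝ) * x + (-(a * (1 - a)) - a ^ 2 / 2)
      rw [max_eq_left (by linarith [hx.1])]
      ring
  have hi1 : IntervalIntegrable (fun x : ℝ => (-(1 / 2 : ℝ)) * x ^ 2 + (1 : ℝ) * x) volume a 1 :=
    ((continuous_const.mul (continuous_pow 2)).add (continuous_const.mul continuous_id)).intervalIntegrable
      a 1
  have hq1 : IntervalIntegrable (fun x : ℝ => (-(1 / 2 : ℝ)) * x ^ 2) volume a 1 :=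
    (continuous_const.mul (continuous_pow 2)).intervalIntegrable a 1
  have hq2 : IntervalIntegrable (fun x : ℝ => (1 : ℝ) * x) volume a 1 :=
    (continuous_const.mul continuous_id).intervalIntegrable a 1
  have hic : IntervalIntegrable (fun _ : ℝ => (-(a * (1 - a)) - a ^ 2 / 2)) volume a 1 :=
    intervalIntegrable_const
  rw [h1, h2, intervalIntegral.integral_const, intervalIntegral.integral_add hi1 hic,
    intervalIntegral.integral_add hq1 hq2, intervalIntegral.integral_const_mul,
    intervalIntegral.integral_const_mul, integral_pow, integral_id, intervalIntegral.integral_const,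
    smul_eq_mul, smul_eq_mul]
  ring

/-- **`8/9` IS ATTAINED AT EVERY `κ ≤ 3/4`** in the layer-cake setting of Part I
(`Scaling/AcceptanceEssEightNinthsIntegral.lean`, weight `b ≥ 0`, density `ρ`): for the
zero-inflated ramp `b_a = (t − a)₊` on `(0, 1]` with `ρ ≡ 1` (`0 ≤ a < 1`),
`Z = ∫ bρ = (1 − a)²/2`, `W = ∫ b²ρ = (1 − a)³/3` and `∫∫ min(b, b′)ρρ′ = (1 − a)³/3 = (8/9)·Z³/W`:
EQUALITY in `ofReal_eight_ninths_le_overlap`; the normalised ESS is `κ = Z²/W = 3(1 − a)/4`, which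
covers `(0, 3/4]`, and the acceptance is `(8/9)·κ = 2(1 − a)/3`. -/
theorem cutRamp_eight_ninths_eq_overlap {a : ℝ} (ha0 : 0 ≤ a) (ha1 : a < 1) :
    (∫⁻ x, ENNReal.ofReal (max (x - a) 0) * 1 ∂(volume.restrict (Ioc (0 : ℝ) 1))
        = ENNReal.ofReal ((1 - a) ^ 2 / 2))
    ∧ (∫⁻ x, ENNReal.ofReal ((max (x - a) 0) ^ 2) * 1 ∂(volume.restrict (Ioc (0 : ℝ) 1))
        = ENNReal.ofReal ((1 - a) ^ 3 / 3))
    ∧ (∫⁻ x, ∫⁻ y, ENNReal.ofReal (min (max (x - a) 0) (max (y - a) 0)) * 1 * 1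
          ∂(volume.restrict (Ioc (0 : ℝ) 1)) ∂(volume.restrict (Ioc (0 : ℝ) 1))
        = ENNReal.ofReal ((1 - a) ^ 3 / 3))
    ∧ ENNReal.ofReal (8 * ((1 - a) ^ 2 / 2) ^ 3 / (9 * ((1 - a) ^ 3 / 3)))
        = ENNReal.ofReal ((1 - a) ^ 3 / 3)
    ∧ ((1 - a) ^ 2 / 2) ^ 2 / ((1 - a) ^ 3 / 3) = 3 * (1 - a) / 4
    ∧ ((1 - a) ^ 3 / 3) / ((1 - a) ^ 2 / 2) = 8 / 9 * (3 * (1 - a) / 4) := by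
  have h1a : 0 < 1 - a := by linarith
  have hcont : Continuous fun t : ℝ => max (t - a) 0 :=
    (continuous_id.sub continuous_const).max continuous_const
  have hI1 : IntegrableOn (fun t : ℝ => max (t - a) 0) (Ioc 0 1) volume :=
    hcont.integrableOn_Icc.mono_set Ioc_subset_Icc_self
  have hI2 : IntegrableOn (fun t : ℝ => (max (t - a) 0) ^ 2) (Ioc 0 1) volume :=
    (hcont.pow 2).integrableOn_Icc.mono_set Ioc_subset_Icc_self
  have hImin : ∀ x, IntegrableOn (fun y : ℝ => min (max (x - a) 0) (max (y - a) 0)) (Ioc 0 1) volume :=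
    fun x => (continuous_const.min hcont).integrableOn_Icc.mono_set Ioc_subset_Icc_self
  refine ⟨?_, ?_, ?_, ?_, ?_, ?_⟩
  · simp_rw [mul_one]
    rw [← ofReal_integral_eq_lintegral_ofReal hI1 (Filter.Eventually.of_forall fun t =>
      le_max_right _ _), integral_cutRamp ha0 ha1.le]
  · simp_rw [mul_one]
    rw [← ofReal_integral_eq_lintegral_ofReal hI2 (Filter.Eventually.of_forall fun t => sq_nonneg _),
      integral_cutRamp_sq ha0 ha1.le]
  · simp_rw [mul_one]
    have inner : ∀ x, ∫⁻ y, ENNReal.ofReal (min (max (x - a) 0) (max (y - a) 0))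
          ∂(volume.restrict (Ioc (0 : ℝ) 1))
        = ENNReal.ofReal (∫ y in Ioc (0 : ℝ) 1, min (max (x - a) 0) (max (y - a) 0)) := fun x =>
      (ofReal_integral_eq_lintegral_ofReal (hImin x) (Filter.Eventually.of_forall fun y =>
        le_min (le_max_right _ _) (le_max_right _ _))).symm
    simp_rw [inner]
    -- the outer integrand is integrable: it agrees on `(0, 1]` with a continuous function
    have hOut : IntegrableOn (fun x : ℝ => ∫ y in Ioc (0 : ℝ) 1, min (max (x - a) 0) (max (y - a) 0))
        (Ioc 0 1) volume := by
      refine IntegrableOn.congr_fun (f := fun x : ℝ => (max (x - a) 0) * (1 - a) - (max (x - a) 0) ^ 2 / 2)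
        (((hcont.mul continuous_const).sub ((hcont.pow 2).div_const 2)).integrableOn_Icc.mono_set
          Ioc_subset_Icc_self) (fun x hx => ?_) measurableSet_Ioc
      show (max (x - a) 0) * (1 - a) - (max (x - a) 0) ^ 2 / 2
        = ∫ y in Ioc (0 : ℝ) 1, min (max (x - a) 0) (max (y - a) 0)
      rcases le_or_gt x a with h | h
      · rw [max_eq_right (by linarith)]
        have e0 : ∫ y in Ioc (0 : ℝ) 1, min (0 : ℝ) (max (y - a) 0) = ∫ y in Ioc (0 : ℝ) 1, (0 : ℝ) :=
          setIntegral_congr_fun measurableSet_Ioc fun y _ => min_eq_left (le_max_right _ _)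
        rw [e0, integral_zero]
        ring
      · rw [integral_min_cutRamp ha0 h hx.2, max_eq_left (by linarith)]
    rw [← ofReal_integral_eq_lintegral_ofReal hOut (Filter.Eventually.of_forall fun x =>
      integral_nonneg fun y => le_min (le_max_right _ _) (le_max_right _ _)),
      integral_integral_min_cutRamp ha0 ha1.le]
  · congr 1
    have h1a' : (1 - a) ≠ 0 := h1a.ne'
    field_simp
    ring
  · have h1a' : (1 - a) ≠ 0 := h1a.ne'
    field_simp
    ring
  · have h1a' : (1 - a) ≠ 0 := h1a.ne'
    field_simp
    ring

end Summit.Ventures.LatticeQCDFlow.Theory2
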